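import Summits.QuantumFields.YangMills.Theorems.BalabanUVNodesN18CornerKernelsOfKernelLetters
import Literature.MathematicalPhysics.QuantumFieldTheory.Balaban1983to89.T4BetaStationary

/-!
# BalabanUVNodes ∕ N18 — THE STATIONARY (LEVEL-∞) KERNEL OF THE MERGED TERM's (1.21) KERNELS FROM N18's LETTER, AND (1.22) AT LEVEL ∞: read along the prefixes
# `revHist h k = (h k, …, h 0)` of ONE box-valued REVERSED coupling history `h` (node U2 ∕ P1's `T4BetaStationary` orientation: `h 0` = the last coupling), def-W1's
# prepend pairing IS the passage `k ↦ k + 1`, so `KernelStepRate` makes EVERY KERNEL ENTRY an `HBeta`-shaped family with node U2's `ScaleShiftRate`; hence (P1 BY NAME) the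
# level-`(k+1)` kernels `Π_{k+1,μν}(revHist h k; z)` converge geometrically to ONE STATIONARY KERNEL `Π_∞(h)(μ,ν,z) := betaInf (entry μ ν z) h`, (5.10)-class, with N22's
# fading memory as its memory profile; ★ the (1.22) recipe SURVIVES the level limit — `betaInf (betaMerged F ℰ ρ bV) h = Σ_z Π_∞(h)(0,1,z)·z₀z₁` — so node U2's «one continuum
# β-function» of the merged β is the second moment of one stationary kernel functional; ★ at the UV CORNER the iterated limits `k → ∞` ∕ `t → 0⁺` COMMUTE: `Π_∞(t,t,…) → Π⁰_∞`
# (g4 FILE 3's limit kernel) and `betaInf (betaMerged …)(t,t,…) →` g4's corner limit number, with linear rates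
# (Track A, DAG node N18 = NE5; cluster K4 «SpineRates»; key K3⁷ `SpineGivenEndpointR13SepCoPH` = stmt-QuantumFields-20544, skeleton v5 941dddb108cbaacf; width seat
# `pub-ymgap-dag-n18-w1` g5, FILE 1 of 2 — successor piece of the g4 corner series FILE 3 `…N18CornerKernelsOfKernelLetters` p615712 ∕ FILE 4 `…N18CornerDriftOfKernelLetters` p617459;
# FILE 2 = `…N18StationaryKernelOfKernelLettersCorner`: the corner face and the record editions)

HONEST FRAMING.  Count-neutral kernel bookkeeping BY NAME (`--kind proof --supports stmt-QuantumFields-20544 --as helper`).  Elementary real analysis — geometric Cauchy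
sequences, dominated summation (pv10∕t4 `secondMoment_sub_abs_le`), uniqueness of limits — over LANDED tree lemmas cited by name: P1's `T4BetaStationary` (`SeqBox`, `revHist`,
`padHist`, `betaInf`, `tendsto_betaInf`, `abs_beta_revHist_sub_betaInf_le`, `abs_beta_sub_betaInf_padHist_le`, `abs_beta_revHist_sub_le_sum`, `sum_profile_le_tsum`,
`sum_profile_le_of_agree`), def-W1's faces (`kernelA_extd`, `kernelB_extd_tail`, `kernelB_eq`, `secondMoment_kernelA_extd`), pv∕flag `T4FlagMemory.tail_mem_box`, dag-n22-w3's `decay510_kernelA_extd_sub_of_ne9` ∕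
`fadingMemory_histModuli_of_fadingMemory`, this seat's g4 FILE 3 (`extd_const`, `histLipschitz_kernelEntry_of_ne9`, `decay510_limitKernel`, `betaPrime510_eq_mul`).  `KernelStepRate`
(N18's input — NE5 NOT PRINTED
for d = 4), kernel NE9 + fading memory (N22's input) and the (5.10) clause ((D4)'s input) are DISPLAYED HYPOTHESES — nothing of Bałaban's is asserted, inhabited or discharged; the
stationary kernel is the CANONICAL `limUnder` term `betaInf` of P1 read entrywise (no `def`); NO value, sign or identification of `Π_∞` or of the corner number is claimed; N17 ∕ N18 ∕
N22 NOT discharged; K3⁷ OPEN (v5), `stub_rates13H` ∕ `stub_expansion13H` NOT proved; K2's one bit (the corner sign) NOT touched.  Counts UNMOVED (typed 28∕28 · discharged 5∕27,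
A 5∕28).  One finite four-torus programme at fixed `ε`, Bałaban AS PRINTED; route R4 closes ONLY the conditional finite-𝕋⁴ rung `BalabanLadder.UV` — NOT the continuum limit, NOT ℝ⁴,
NOT OS, NOT the Yang–Mills mass gap, NOT Clay.  THEOREMS ONLY: 0 `def`, 0 `instance`, 0 `sorry`, standard axioms.

WHY.  Under K3⁷ v5's node-U3 pin the N18 conjunct at the bundle of record COSTS EXACTLY W1-19b's letter `KernelStepRateOfRecord₁₃ F N θ ℓ.κ ℓ.θ₅ ℓ.C₅` (g2 p597580):
`|Π_{k+1}(g; z) − Π_{k+2}(b, g; z)| ≤ C₅ θ₅^{k+1} e^{−κ|z|₁}` on `]0,θ.γ]^ℕ` — prepending `b` at the ULTRAVIOLET end.  Read from the infrared end along ONE semi-infinite history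
this is a CAUCHY condition in the level: the letter says that the merged term's vacuum-polarisation kernels, k levels deep, forget how deep they are at the η-rate.  Node U2's
P1 module (`T4BetaStationary`, [I] p. 255 «(d∕ds)(1∕g²) = −β(g) … we can take one function β instead of the sequence β_j» as MOTIVATION) typed exactly this for the β-FUNCTIONS
under NE4's `ScaleShiftRate`; g2 showed `KernelStepRate` + (UD) ⟹ that `ScaleShiftRate` for the merged β (second moments).  This file goes one printed step DEEPER, to the (1.21)
kernels themselves: the stationary object is a KERNEL functional `Π_∞(h)`, and the (1.22) recipe `β = Σ_z Π(0,1,z) z₀z₁` commutes with the level limit (dominated summation under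
the (5.10) class) — so every question about the continuum functional of the merged β (its UV corner value, whose SIGN is K2's one bit; its memory) is a question about ONE kernel
per reversed history; and g4's corner objects (corner kernels `Π⁰_k`, limit kernel `Π⁰_∞`, corner numbers and their limit) are its face values at the zero history, reached
along the diagonal `(t,t,…)`, `t → 0⁺`, with the two iterated limits commuting at a linear rate in `t`.

WHAT (theorems only).  §1 generic term family: `kernelA_extd_succ_eq_prepend` (def-W1's pairing at a box history: `Π_{k+2}(extd w) = Π_{k+2}(prepend (w 0) (extd (tail w)))`)
· `extd_revHist_const` · ★ `scaleShiftRate_kernelEntry_of_kernelStepRate` (the U3 → U2 edge ENTRYWISE) · `fadingMemory_kernelEntryModuli`.  §2 ★★ `tendsto_kernelEntry_revHist_stationary` ·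
`abs_kernelEntry_revHist_sub_stationary_le` (tail `C₅θ^{k+1}e^{−κ|z|₁}∕(1−θ)`) · `abs_kernelEntry_sub_stationary_padHist_le` (box representation) · `decay510_stationaryKernel` ·
`exists_decay510_stationaryKernel_of_kernelDecay` · `decay510_stationaryKernel_of_decayBound` (uniform in `h`).  §3 `abs_kernelEntry_revHist_sub_le_sum` · ★ `memoryProfile_stationaryKernel_of_ne9`
(`|Π_∞(h; z) − Π_∞(h′; z)| ≤ e^{−κ|z|₁}·C₉ω·Σ'_j ω^j |h j − h′ j|`; SEPARATE ratios: `θ` for the level tail, `ω` for the memory) · `abs_stationaryKernel_sub_le_of_agree` (depth form) ·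
`abs_stationaryKernel_sub_le` (uniform form).  §4 ★★ `abs_betaMerged_revHist_sub_secondMoment_stationaryKernel_le` · ★★ `tendsto_betaMerged_revHist_secondMoment_stationaryKernel` ·
★★ `betaInf_betaMerged_eq_secondMoment_stationaryKernel` ((1.22) AT LEVEL ∞; the β-level `ScaleShiftRate` ∕ (UD) letter NOT assumed — per-sequence (5.10) suffices) ·
`tendsto_betaMerged_revHist_betaInf` · `abs_betaMerged_sub_secondMoment_stationaryKernel_padHist_le` (β-level representation).  FILE 2 of the pair (`…N18StationaryKernelOfKernelLettersCorner`): §5 THE CORNER FACE (the iterated limits `k → ∞` ∕ `t → 0⁺` commute; g4's corner limit number IS the UV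
corner value of node U2's functional) and §6 the RECORD editions at `objectsOfRecord₁₃ F N θ ℓ` (K3⁷ v5 pin currency).

References (TYPES ∕ locators only): [Balaban1987RG1] CMP **109** (1987): p. 255 (one β-function: motivation only), Thm 1 p. 259 (NE5 NOT printed), (1.18) p. 263, (1.20)–(1.22)
p. 264, (2.12)–(2.14) p. 268, §5 p. 298, (5.10) p. 293, (5.42) p. 297.
-/

noncomputable section

open Filter Topology
open scoped BigOperators

namespace YMDAG.N18.StationaryKernelOfKernelLetters

open Literature.MathematicalPhysics.QuantumFieldTheory.Balaban1983to89
open Literature.MathematicalPhysics.QuantumFieldTheory.Balaban1983to89.T4Continuum (T4Family)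
open Literature.MathematicalPhysics.QuantumFieldTheory.Balaban1983to89.T4OutputRate (Window NE9 DecayBound)
open Literature.MathematicalPhysics.QuantumFieldTheory.Balaban1983to89.FlowStep (Box HBeta mem_box)
open Literature.MathematicalPhysics.QuantumFieldTheory.Balaban1983to89.B12Beta (secondMoment)
open Literature.MathematicalPhysics.QuantumFieldTheory.Balaban1983to89.T4CouplingMatching (ScaleShiftRate HistLipschitz FadingMemory)
open Literature.MathematicalPhysics.QuantumFieldTheory.Balaban1983to89.T4FlagMemory (extd extd_coe tail_mem_box)
open Literature.MathematicalPhysics.QuantumFieldTheory.Balaban1983to89.T4BetaReadOut (extd_mem_window)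
open Literature.MathematicalPhysics.QuantumFieldTheory.Balaban1983to89.T4BetaReadOutLipschitz (secondMoment_sub_abs_le)
open Literature.MathematicalPhysics.QuantumFieldTheory.Balaban1983to89.T4BetaStationary (SeqBox revHist padHist betaInf MemoryProfile revHist_mem_box tail_revHist
  revHist_zero revHist_padHist padHist_seqBox abs_beta_revHist_sub_le_sum sum_profile_le_tsum sum_profile_le_of_agree tsum_profile_le constant_nonneg_of_fadingMemory)
open Literature.MathematicalPhysics.QuantumFieldTheory.Balaban1983to89.Node00 (TermFamily1 betaMerged prependCoupling)
open Literature.MathematicalPhysics.QuantumFieldTheory.Balaban1983to89.Node00.U3OfKernels (kernelA kernelB EA KernelDecay kernelA_extd kernelB_extd_tail kernelB_eq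
  decayBound_EA_iff secondMoment_kernelA_extd)
open Literature.MathematicalPhysics.QuantumFieldTheory.Balaban1983to89.Node00.U3KernelLetters (KernelStepRate)
open Literature.MathematicalPhysics.QuantumFieldTheory.Balaban1983to89.B12Sec2to5 (l1 l1_nonneg Decay510 betaPrime510)
open YMDAG.N22.AtKernels (decay510_kernelA_extd_sub_of_ne9 fadingMemory_histModuli_of_fadingMemory)
open YMDAG.N18.CornerKernelsOfKernelLetters (extd_const histLipschitz_kernelEntry_of_ne9 decay510_limitKernel betaPrime510_eq_mul)

variable {𝔄 : Type*} [NormedRing 𝔄] [NormedAlgebra ℝ 𝔄]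
variable {V : Type*} [NormedAddCommGroup V] [NormedSpace ℝ V] {ι : Type*} [Fintype ι]
variable (F : T4Family) (ℰ : TermFamily1 F 𝔄) (ρ : V →L[ℝ] 𝔄) (bV : Module.Basis ι ℝ V)

/-! ## §1 def-W1's prepend pairing IS the passage `k ↦ k + 1` along a reversed history; N18's letter ⟹ node U2's `ScaleShiftRate` for EVERY KERNEL ENTRY -/

/-- **def-W1's PAIRING AT A BOX HISTORY**: the level-`(k+2)` kernel along the padded box history `w = (w_0, …, w_{k+1})` IS run A's kernel of the sequence with `w_0` PREPENDED to the
padded tail `(w_1, …, w_{k+1})` — both are `polLimit F (k+2) (ℰ (k+1) w ·)` (`kernelA_extd`, `kernelB_extd_tail`). [cite: Balaban1987RG1, (1.21) p.264 and (0.24)-(0.25) p.257 (pairing NOT printed; bookkeeping)] -/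
theorem kernelA_extd_succ_eq_prepend {k : ℕ} (w : Fin (k + 2) → ℝ) :
    kernelA F ℰ ρ bV (prependCoupling (w 0) (extd (Fin.tail w))) (k + 1) = kernelA F ℰ ρ bV (extd w) (k + 1) := by
  have h1 := kernelB_extd_tail F ℰ ρ bV w
  have h2 := kernelA_extd F ℰ ρ bV w
  rw [kernelB_eq] at h1
  exact h1.trans h2.symm

/-- The padded prefixes of a CONSTANT reversed history are the constant sequence (the prefixes are the diagonal box histories — the β sub-cell's `revHist_const`, here inlined —
and g4 FILE 3's `extd_const`). [folklore] -/
theorem extd_revHist_const (t : ℝ) (k : ℕ) : extd (revHist (fun _ : ℕ => t) k) = fun _ : ℕ => t := by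
  have e : revHist (fun _ : ℕ => t) k = fun _ : Fin (k + 1) => t := rfl
  rw [e, extd_const]

/-- ★ **THE U3 → U2 EDGE, ENTRYWISE: N18's LETTER ⟹ node U2's `ScaleShiftRate` FOR EVERY KERNEL ENTRY.**  Under `KernelStepRate F ℰ ρ bV γ κ θ C₅` — `|Π_{k+1}(g; z) − Π_{k+2}(b, g; z)|
≤ C₅ θ^{k+1} e^{−κ|z|₁}` for `b ∈ ]0,γ]`, `g ∈ ]0,γ]^ℕ` — the `HBeta`-shaped family `(k, v) ↦ Π_{k+1,μν}(extd v; z)` of ONE kernel entry satisfies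
`ScaleShiftRate (C₅·θ·e^{−κ|z|₁}) θ γ`: dropping the finest coupling of a box history moves the entry by `≤ (C₅θe^{−κ|z|₁})·θ^k` (the prepend pairing of §1 with `b = w_0`).  g2's
`scaleShiftRate_betaMerged_of_kernelStepRate` (p594018) is the second-moment shadow of this; g4 FILE 3's `histLipschitz_kernelEntry_of_ne9` is the companion `HistLipschitz`.  NE5 NOT
PRINTED for d = 4 — binder; N18 NOT discharged. [cite: Balaban1987RG1, Thm 1 p.259 and (1.20)-(1.22) p.264] -/
theorem scaleShiftRate_kernelEntry_of_kernelStepRate {γ κ θ C₅ : ℝ} (h18 : KernelStepRate F ℰ ρ bV γ κ θ C₅) (μ ν : Fin 4) (z : Fin 4 → ℤ) :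
    ScaleShiftRate (C₅ * θ * Real.exp (-(κ * l1 z))) θ γ (fun k v => kernelA F ℰ ρ bV (extd v) k μ ν z) := by
  intro k w hw
  have hw0 : 0 < w 0 ∧ w 0 ≤ γ := (mem_box.1 hw) 0
  have h := h18 (w 0) hw0.1 hw0.2 (extd (Fin.tail w)) (extd_mem_window (tail_mem_box hw)) k μ ν z
  rw [kernelA_extd_succ_eq_prepend, abs_sub_comm] at h
  show |kernelA F ℰ ρ bV (extd w) (k + 1) μ ν z - kernelA F ℰ ρ bV (extd (Fin.tail w)) k μ ν z| ≤ _
  refine h.trans (le_of_eq ?_)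
  ring

/-- The ENTRY MODULI `e^{−κ|z|₁}·Λ (k+1) i` of g4 FILE 3's `histLipschitz_kernelEntry_of_ne9` inherit node U3's fading memory `0 ≤ Λ a i ≤ C₉ω^{a−i}` at the shifted index, in node U2's
currency: `FadingMemory (e^{−κ|z|₁}·C₉·ω) ω` (dag-n22-w3's `fadingMemory_histModuli_of_fadingMemory` at `M = e^{−κ|z|₁}`). [cite: Balaban1987RG1, §5 p.298 (fading memory NOT printed; bookkeeping)] -/
theorem fadingMemory_kernelEntryModuli {C₉ ω : ℝ} {Λ : ℕ → ℕ → ℝ} (hF : T4OutputRate.FadingMemory C₉ ω Λ) (κ : ℝ) (z : Fin 4 → ℤ) :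
    FadingMemory (Real.exp (-(κ * l1 z)) * C₉ * ω) ω (fun k i => Real.exp (-(κ * l1 z)) * Λ (k + 1) i) :=
  fadingMemory_histModuli_of_fadingMemory (M := Real.exp (-(κ * l1 z))) (Real.exp_nonneg _) hF

/-! ## §2 The STATIONARY KERNEL `Π_∞(h)(μ,ν,z) := betaInf (entry μ ν z) h` along a box-valued reversed history: convergence at the η-rate, box representation, (5.10) class -/

/-- ★★ **THE LEVEL-`(k+1)` KERNELS ALONG ONE REVERSED HISTORY CONVERGE TO THE STATIONARY KERNEL** (`θ < 1`; P1's `tendsto_betaInf` applied to the entry family of §1): for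
`SeqBox γ h`, `Π_{k+1,μν}(h k, …, h 0; z) → Π_∞(h)(μ,ν,z) := betaInf (fun k v => Π_{k+1,μν}(extd v; z)) h` as `k → ∞` — ONE kernel per semi-infinite history, the level forgotten.
[cite: Balaban1987RG1, Thm 1 p.259, (1.20)-(1.21) p.264 and p.255 (motivation)] -/
theorem tendsto_kernelEntry_revHist_stationary {γ κ θ C₅ : ℝ} (h18 : KernelStepRate F ℰ ρ bV γ κ θ C₅) (hθ1 : θ < 1) {h : ℕ → ℝ} (hh : SeqBox γ h)
    (μ ν : Fin 4) (z : Fin 4 → ℤ) :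
    Tendsto (fun k : ℕ => kernelA F ℰ ρ bV (extd (revHist h k)) k μ ν z) atTop
      (𝓝 (betaInf (fun k v => kernelA F ℰ ρ bV (extd v) k μ ν z) h)) :=
  T4BetaStationary.tendsto_betaInf (scaleShiftRate_kernelEntry_of_kernelStepRate F ℰ ρ bV h18 μ ν z) hθ1 hh

/-- **THE GEOMETRIC TAIL**: `|Π_{k+1,μν}(revHist h k; z) − Π_∞(h)(μ,ν,z)| ≤ C₅ θ^{k+1} e^{−κ|z|₁} ∕ (1 − θ)` (P1's `abs_beta_revHist_sub_betaInf_le`).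
[cite: Balaban1987RG1, Thm 1 p.259 and (1.20)-(1.21) p.264] -/
theorem abs_kernelEntry_revHist_sub_stationary_le {γ κ θ C₅ : ℝ} (h18 : KernelStepRate F ℰ ρ bV γ κ θ C₅) (hθ1 : θ < 1) {h : ℕ → ℝ} (hh : SeqBox γ h)
    (μ ν : Fin 4) (z : Fin 4 → ℤ) (k : ℕ) :
    |kernelA F ℰ ρ bV (extd (revHist h k)) k μ ν z - betaInf (fun k v => kernelA F ℰ ρ bV (extd v) k μ ν z) h| ≤
      C₅ * θ ^ (k + 1) * Real.exp (-(κ * l1 z)) / (1 - θ) := by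
  have e := T4BetaStationary.abs_beta_revHist_sub_betaInf_le (scaleShiftRate_kernelEntry_of_kernelStepRate F ℰ ρ bV h18 μ ν z) hθ1 hh k
  refine e.trans (le_of_eq ?_)
  ring

/-- **BOX REPRESENTATION**: for every box history `v ∈ ]0,γ]^{k+1}` and every padding value `p ∈ ]0,γ]`, `|Π_{k+1,μν}(extd v; z) − Π_∞(padHist p v)(μ,ν,z)| ≤ C₅ θ^{k+1} e^{−κ|z|₁}∕(1−θ)`
— the level-`(k+1)` kernel IS the stationary kernel of (any box continuation of) its own reversed history, up to the geometric tail (P1's `abs_beta_sub_betaInf_padHist_le`).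
[cite: Balaban1987RG1, Thm 1 p.259 and (1.20)-(1.21) p.264] -/
theorem abs_kernelEntry_sub_stationary_padHist_le {γ κ θ C₅ p : ℝ} (h18 : KernelStepRate F ℰ ρ bV γ κ θ C₅) (hθ1 : θ < 1) (hp0 : 0 < p) (hpγ : p ≤ γ)
    {k : ℕ} {v : Fin (k + 1) → ℝ} (hv : v ∈ Box γ k) (μ ν : Fin 4) (z : Fin 4 → ℤ) :
    |kernelA F ℰ ρ bV (extd v) k μ ν z - betaInf (fun k v => kernelA F ℰ ρ bV (extd v) k μ ν z) (padHist p v)| ≤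
      C₅ * θ ^ (k + 1) * Real.exp (-(κ * l1 z)) / (1 - θ) := by
  have e := T4BetaStationary.abs_beta_sub_betaInf_padHist_le (scaleShiftRate_kernelEntry_of_kernelStepRate F ℰ ρ bV h18 μ ν z) hθ1 hp0 hpγ hv
  refine e.trans (le_of_eq ?_)
  ring

/-- **THE STATIONARY KERNEL IS (5.10)-CLASS**: from the (5.10) clause of the level-1 kernel at the age-0 prefix `(h 0)` and the tail at `k = 0`, constant `C₀ + C₅θ∕(1−θ)` (g4 FILE 3's
`decay510_limitKernel` read at the sequence `k ↦ Π_{k+1}(revHist h k)`). [cite: Balaban1987RG1, (5.10) p.293 and (1.20)-(1.21) p.264] -/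
theorem decay510_stationaryKernel {γ κ θ C₅ : ℝ} (h18 : KernelStepRate F ℰ ρ bV γ κ θ C₅) (hθ1 : θ < 1) {h : ℕ → ℝ} (hh : SeqBox γ h) {μ ν : Fin 4} {C₀ : ℝ}
    (hdec : Decay510 (kernelA F ℰ ρ bV (extd (revHist h 0)) 0 μ ν) C₀ κ) :
    Decay510 (fun z => betaInf (fun k v => kernelA F ℰ ρ bV (extd v) k μ ν z) h) (C₀ + C₅ * θ / (1 - θ)) κ :=
  decay510_limitKernel (P0 := fun k => kernelA F ℰ ρ bV (extd (revHist h k)) k) (Pinf := fun μ ν z => betaInf (fun k v => kernelA F ℰ ρ bV (extd v) k μ ν z) h)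
    hdec (fun k z => abs_kernelEntry_revHist_sub_stationary_le F ℰ ρ bV h18 hθ1 hh μ ν z k)

/-- The same from W1-19's (5.10)-CLASS CLAUSE ON THE WINDOW `KernelDecay F ℰ ρ bV (Window γ) μ ν κ` (one constant per coupling sequence; here the padded age-0 prefix).
[cite: Balaban1987RG1, (5.10) p.293] -/
theorem exists_decay510_stationaryKernel_of_kernelDecay {γ κ θ C₅ : ℝ} (h18 : KernelStepRate F ℰ ρ bV γ κ θ C₅) (hθ1 : θ < 1) {μ ν : Fin 4}
    (hdec : KernelDecay F ℰ ρ bV (Window γ) μ ν κ) {h : ℕ → ℝ} (hh : SeqBox γ h) :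
    ∃ C : ℝ, Decay510 (fun z => betaInf (fun k v => kernelA F ℰ ρ bV (extd v) k μ ν z) h) C κ := by
  obtain ⟨C₀, hC₀⟩ := hdec (extd (revHist h 0)) (extd_mem_window (revHist_mem_box hh 0))
  exact ⟨_, decay510_stationaryKernel F ℰ ρ bV h18 hθ1 hh (hC₀ 0)⟩

/-- The same, UNIFORMLY IN THE HISTORY, from node U3's own decay slot `DecayBound (EA F ℰ ρ bV) (Window γ) E₀ κ` ((0.25)∕(1.18) shape, ONE constant): `Π_∞(h)` is (5.10)-class with
constant `E₀ + C₅θ∕(1−θ)` for every box-valued `h`. [cite: Balaban1987RG1, (1.18) p.263 and (5.10) p.293] -/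
theorem decay510_stationaryKernel_of_decayBound {γ κ θ C₅ E₀ : ℝ} (h18 : KernelStepRate F ℰ ρ bV γ κ θ C₅) (hθ1 : θ < 1)
    (hUD : DecayBound (EA F ℰ ρ bV) (Window γ) E₀ κ) {h : ℕ → ℝ} (hh : SeqBox γ h) (μ ν : Fin 4) :
    Decay510 (fun z => betaInf (fun k v => kernelA F ℰ ρ bV (extd v) k μ ν z) h) (E₀ + C₅ * θ / (1 - θ)) κ :=
  decay510_stationaryKernel F ℰ ρ bV h18 hθ1 hh
    ((decayBound_EA_iff F ℰ ρ bV (Window γ) E₀ κ).1 hUD (extd (revHist h 0)) (extd_mem_window (revHist_mem_box hh 0)) 0 μ ν)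

/-! ## §3 N22's kernel NE9 + fading memory ⟹ the stationary kernel's GEOMETRIC MEMORY PROFILE (separate ratios: `θ` for the level tail, `ω` for the memory) -/

/-- LEVEL-`k` PROFILE: `|Π_{k+1,μν}(revHist h k; z) − Π_{k+1,μν}(revHist h′ k; z)| ≤ Σ_{j ≤ k} (e^{−κ|z|₁}C₉ω)·ω^j·|h j − h′ j|` (g4 FILE 3's entrywise `HistLipschitz` + §1's entry moduli, P1's
`abs_beta_revHist_sub_le_sum`). [cite: Balaban1987RG1, (1.18) p.263, (1.20)-(1.21) p.264 and §5 p.298] -/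
theorem abs_kernelEntry_revHist_sub_le_sum {γ κ C₉ ω : ℝ} {Λ : ℕ → ℕ → ℝ} (h9 : NE9 (EA F ℰ ρ bV) (Window γ) κ Λ) (hF : T4OutputRate.FadingMemory C₉ ω Λ)
    {h h' : ℕ → ℝ} (hh : SeqBox γ h) (hh' : SeqBox γ h') (μ ν : Fin 4) (z : Fin 4 → ℤ) (k : ℕ) :
    |kernelA F ℰ ρ bV (extd (revHist h k)) k μ ν z - kernelA F ℰ ρ bV (extd (revHist h' k)) k μ ν z| ≤
      ∑ j ∈ Finset.range (k + 1), (Real.exp (-(κ * l1 z)) * C₉ * ω) * ω ^ j * |h j - h' j| :=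
  abs_beta_revHist_sub_le_sum (histLipschitz_kernelEntry_of_ne9 F ℰ ρ bV h9 μ ν z) (fadingMemory_kernelEntryModuli hF κ z) hh hh' k

/-- ★ **THE STATIONARY KERNEL HAS GEOMETRIC FADING MEMORY** (P1's `MemoryProfile` shape, constant `e^{−κ|z|₁}·C₉·ω`, ratio `ω`): for box-valued reversed histories `h, h′`,
`|Π_∞(h)(μ,ν,z) − Π_∞(h′)(μ,ν,z)| ≤ e^{−κ|z|₁}·C₉ω·Σ'_j ω^j |h j − h′ j|` — the coupling `j` scales towards the ultraviolet moves the stationary kernel by `O(ω^j)`.  Inputs: N18's letter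
(`θ < 1`, for the limits) and N22's kernel NE9 with fading memory (`0 ≤ ω < 1`); both UNPRINTED, displayed. [cite: Balaban1987RG1, (1.20)-(1.21) p.264 and §5 p.298] -/
theorem memoryProfile_stationaryKernel_of_ne9 {γ κ θ C₅ C₉ ω : ℝ} {Λ : ℕ → ℕ → ℝ} (h18 : KernelStepRate F ℰ ρ bV γ κ θ C₅) (hθ1 : θ < 1)
    (h9 : NE9 (EA F ℰ ρ bV) (Window γ) κ Λ) (hF : T4OutputRate.FadingMemory C₉ ω Λ) (hω0 : 0 ≤ ω) (hω1 : ω < 1) (μ ν : Fin 4) (z : Fin 4 → ℤ) :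
    MemoryProfile (Real.exp (-(κ * l1 z)) * C₉ * ω) ω γ (betaInf (fun k v => kernelA F ℰ ρ bV (extd v) k μ ν z)) := by
  intro h h' hh hh'
  have hCm : 0 ≤ Real.exp (-(κ * l1 z)) * C₉ * ω := constant_nonneg_of_fadingMemory (fadingMemory_kernelEntryModuli hF κ z)
  have ht := ((tendsto_kernelEntry_revHist_stationary F ℰ ρ bV h18 hθ1 hh μ ν z).sub
    (tendsto_kernelEntry_revHist_stationary F ℰ ρ bV h18 hθ1 hh' μ ν z)).abs
  refine le_of_tendsto' ht fun k => ?_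
  calc |kernelA F ℰ ρ bV (extd (revHist h k)) k μ ν z - kernelA F ℰ ρ bV (extd (revHist h' k)) k μ ν z|
      ≤ ∑ j ∈ Finset.range (k + 1), (Real.exp (-(κ * l1 z)) * C₉ * ω) * ω ^ j * |h j - h' j| :=
        abs_kernelEntry_revHist_sub_le_sum F ℰ ρ bV h9 hF hh hh' μ ν z k
    _ = (Real.exp (-(κ * l1 z)) * C₉ * ω) * ∑ j ∈ Finset.range (k + 1), ω ^ j * |h j - h' j| := by
        rw [Finset.mul_sum]
        exact Finset.sum_congr rfl fun j _ => by ring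
    _ ≤ (Real.exp (-(κ * l1 z)) * C₉ * ω) * ∑' j, ω ^ j * |h j - h' j| :=
        mul_le_mul_of_nonneg_left (sum_profile_le_tsum hω0 hω1 hh hh' (k + 1)) hCm

/-- **DEPTH FORM**: two box-valued reversed histories that AGREE at all ages `j < N` have stationary kernels within `e^{−κ|z|₁}·C₉ω·γω^N∕(1−ω)` — what happened more than `N` scales
towards the ultraviolet is invisible up to a geometric amount (P1's `sum_profile_le_of_agree`). [cite: Balaban1987RG1, (1.20)-(1.21) p.264 and §5 p.298] -/
theorem abs_stationaryKernel_sub_le_of_agree {γ κ θ C₅ C₉ ω : ℝ} {Λ : ℕ → ℕ → ℝ} (h18 : KernelStepRate F ℰ ρ bV γ κ θ C₅) (hθ1 : θ < 1)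
    (h9 : NE9 (EA F ℰ ρ bV) (Window γ) κ Λ) (hF : T4OutputRate.FadingMemory C₉ ω Λ) (hω0 : 0 ≤ ω) (hω1 : ω < 1) {h h' : ℕ → ℝ} (hh : SeqBox γ h)
    (hh' : SeqBox γ h') {N : ℕ} (hagree : ∀ j, j < N → h j = h' j) (μ ν : Fin 4) (z : Fin 4 → ℤ) :
    |betaInf (fun k v => kernelA F ℰ ρ bV (extd v) k μ ν z) h - betaInf (fun k v => kernelA F ℰ ρ bV (extd v) k μ ν z) h'| ≤
      (Real.exp (-(κ * l1 z)) * C₉ * ω) * (γ * ω ^ N / (1 - ω)) := by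
  have hCm : 0 ≤ Real.exp (-(κ * l1 z)) * C₉ * ω := constant_nonneg_of_fadingMemory (fadingMemory_kernelEntryModuli hF κ z)
  have ht := ((tendsto_kernelEntry_revHist_stationary F ℰ ρ bV h18 hθ1 hh μ ν z).sub
    (tendsto_kernelEntry_revHist_stationary F ℰ ρ bV h18 hθ1 hh' μ ν z)).abs
  refine le_of_tendsto' ht fun k => ?_
  calc |kernelA F ℰ ρ bV (extd (revHist h k)) k μ ν z - kernelA F ℰ ρ bV (extd (revHist h' k)) k μ ν z|
      ≤ ∑ j ∈ Finset.range (k + 1), (Real.exp (-(κ * l1 z)) * C₉ * ω) * ω ^ j * |h j - h' j| :=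
        abs_kernelEntry_revHist_sub_le_sum F ℰ ρ bV h9 hF hh hh' μ ν z k
    _ = (Real.exp (-(κ * l1 z)) * C₉ * ω) * ∑ j ∈ Finset.range (k + 1), ω ^ j * |h j - h' j| := by
        rw [Finset.mul_sum]
        exact Finset.sum_congr rfl fun j _ => by ring
    _ ≤ (Real.exp (-(κ * l1 z)) * C₉ * ω) * (γ * ω ^ N / (1 - ω)) :=
        mul_le_mul_of_nonneg_left (sum_profile_le_of_agree hω0 hω1 hh hh' hagree (k + 1)) hCm

/-- **UNIFORM FORM**: any two stationary kernels of box-valued histories differ by at most `e^{−κ|z|₁}·C₉ω·γ∕(1−ω)` (P1's `tsum_profile_le`). [cite: Balaban1987RG1, (1.20)-(1.21) p.264 and §5 p.298] -/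
theorem abs_stationaryKernel_sub_le {γ κ θ C₅ C₉ ω : ℝ} {Λ : ℕ → ℕ → ℝ} (h18 : KernelStepRate F ℰ ρ bV γ κ θ C₅) (hθ1 : θ < 1)
    (h9 : NE9 (EA F ℰ ρ bV) (Window γ) κ Λ) (hF : T4OutputRate.FadingMemory C₉ ω Λ) (hω0 : 0 ≤ ω) (hω1 : ω < 1) {h h' : ℕ → ℝ} (hh : SeqBox γ h)
    (hh' : SeqBox γ h') (μ ν : Fin 4) (z : Fin 4 → ℤ) :
    |betaInf (fun k v => kernelA F ℰ ρ bV (extd v) k μ ν z) h - betaInf (fun k v => kernelA F ℰ ρ bV (extd v) k μ ν z) h'| ≤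
      (Real.exp (-(κ * l1 z)) * C₉ * ω) * (γ / (1 - ω)) :=
  (memoryProfile_stationaryKernel_of_ne9 F ℰ ρ bV h18 hθ1 h9 hF hω0 hω1 μ ν z h h' hh hh').trans
    (mul_le_mul_of_nonneg_left (tsum_profile_le hω0 hω1 hh hh') (constant_nonneg_of_fadingMemory (fadingMemory_kernelEntryModuli hF κ z)))

/-! ## §4 (1.22) AT LEVEL ∞: node U2's continuum functional of the merged β IS the second moment of the stationary kernel -/

/-- ★★ **THE MERGED β ALONG A REVERSED HISTORY vs THE (1.22) SECOND MOMENT OF THE STATIONARY KERNEL**: for `0 < κ`, the (5.10)-class clause `KernelDecay F ℰ ρ bV (Window γ) 0 1 κ` (for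
dominated summation only) and N18's letter, `|β_{k+1}(h k, …, h 0) − Σ_z Π_∞(h)(0,1,z) z₀z₁| ≤ (C₅θ^{k+1}∕(1−θ))·betaPrime510 4 1 κ` (`betaMerged = secondMoment ∘ kernelA ∘ extd`, def-W1's
`secondMoment_kernelA_extd`; pv10∕t4 `secondMoment_sub_abs_le` on the tail kernel of §2). [cite: Balaban1987RG1, (1.22) p.264, (5.10) p.293 and (5.42) p.297] -/
theorem abs_betaMerged_revHist_sub_secondMoment_stationaryKernel_le {γ κ θ C₅ : ℝ} (hκ : 0 < κ) (h18 : KernelStepRate F ℰ ρ bV γ κ θ C₅) (hθ1 : θ < 1)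
    (hdec : KernelDecay F ℰ ρ bV (Window γ) 0 1 κ) {h : ℕ → ℝ} (hh : SeqBox γ h) (k : ℕ) :
    |betaMerged F ℰ ρ bV k (revHist h k) - secondMoment (fun μ ν z => betaInf (fun k v => kernelA F ℰ ρ bV (extd v) k μ ν z) h) 0 1| ≤
      C₅ * θ ^ (k + 1) / (1 - θ) * betaPrime510 4 1 κ := by
  obtain ⟨Ck, hCk⟩ := hdec (extd (revHist h k)) (extd_mem_window (revHist_mem_box hh k))
  obtain ⟨C0, hC0⟩ := hdec (extd (revHist h 0)) (extd_mem_window (revHist_mem_box hh 0))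
  have hA : Decay510 (kernelA F ℰ ρ bV (extd (revHist h k)) k 0 1) Ck κ := hCk k
  have hS : Decay510 ((fun μ ν z => betaInf (fun k v => kernelA F ℰ ρ bV (extd v) k μ ν z) h) 0 1) (C0 + C₅ * θ / (1 - θ)) κ :=
    decay510_stationaryKernel F ℰ ρ bV h18 hθ1 hh (hC0 0)
  have hD : Decay510 (fun z => kernelA F ℰ ρ bV (extd (revHist h k)) k 0 1 z -
      (fun μ ν z => betaInf (fun k v => kernelA F ℰ ρ bV (extd v) k μ ν z) h) 0 1 z) (C₅ * θ ^ (k + 1) / (1 - θ)) κ := by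
    intro z
    rw [neg_mul]
    refine (abs_kernelEntry_revHist_sub_stationary_le F ℰ ρ bV h18 hθ1 hh 0 1 z k).trans (le_of_eq ?_)
    ring
  have e := secondMoment_sub_abs_le (Pk := kernelA F ℰ ρ bV (extd (revHist h k)) k)
    (Pk' := fun μ ν z => betaInf (fun k v => kernelA F ℰ ρ bV (extd v) k μ ν z) h) hκ hA hS hD
  rwa [secondMoment_kernelA_extd, betaPrime510_eq_mul] at e

/-- ★★ **THE MERGED β ALONG A REVERSED HISTORY CONVERGES TO THE SECOND MOMENT OF THE STATIONARY KERNEL** (`0 ≤ θ < 1`): `β_{k+1}(h k, …, h 0) → Σ_z Π_∞(h)(0,1,z) z₀z₁`.  The β-level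
`ScaleShiftRate` ∕ the (UD) letter are NOT assumed: N18's kernel letter + the per-sequence (5.10) clause give the existence of node U2's functional for the merged β.
[cite: Balaban1987RG1, (1.22) p.264, (5.10) p.293 and p.255 (motivation)] -/
theorem tendsto_betaMerged_revHist_secondMoment_stationaryKernel {γ κ θ C₅ : ℝ} (hκ : 0 < κ) (h18 : KernelStepRate F ℰ ρ bV γ κ θ C₅) (hθ0 : 0 ≤ θ) (hθ1 : θ < 1)
    (hdec : KernelDecay F ℰ ρ bV (Window γ) 0 1 κ) {h : ℕ → ℝ} (hh : SeqBox γ h) :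
    Tendsto (fun k : ℕ => betaMerged F ℰ ρ bV k (revHist h k)) atTop
      (𝓝 (secondMoment (fun μ ν z => betaInf (fun k v => kernelA F ℰ ρ bV (extd v) k μ ν z) h) 0 1)) := by
  have key : ∀ k : ℕ, ‖betaMerged F ℰ ρ bV k (revHist h k) -
      secondMoment (fun μ ν z => betaInf (fun k v => kernelA F ℰ ρ bV (extd v) k μ ν z) h) 0 1‖ ≤ (C₅ / (1 - θ) * betaPrime510 4 1 κ * θ) * θ ^ k := fun k => by
    rw [Real.norm_eq_abs]
    refine (abs_betaMerged_revHist_sub_secondMoment_stationaryKernel_le F ℰ ρ bV hκ h18 hθ1 hdec hh k).trans (le_of_eq ?_)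
    ring
  have h0 : Tendsto (fun k : ℕ => (C₅ / (1 - θ) * betaPrime510 4 1 κ * θ) * θ ^ k) atTop (𝓝 0) := by
    have := (tendsto_pow_atTop_nhds_zero_of_lt_one hθ0 hθ1).const_mul (C₅ / (1 - θ) * betaPrime510 4 1 κ * θ)
    rwa [mul_zero] at this
  exact tendsto_sub_nhds_zero_iff.1 (squeeze_zero_norm' (Eventually.of_forall key) h0)

/-- ★★ **(1.22) AT LEVEL ∞**: `betaInf (betaMerged F ℰ ρ bV) h = Σ_z Π_∞(h)(0,1,z)·z₀z₁` — node U2's continuum β-functional of the merged β ([I] p. 255's «one function β», P1's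
`betaInf`) IS the (1.22) second moment of ONE stationary kernel functional of the reversed history (uniqueness of limits).  Nothing of Bałaban asserted: three displayed letters.
[cite: Balaban1987RG1, (1.22) p.264 and p.255 (motivation)] -/
theorem betaInf_betaMerged_eq_secondMoment_stationaryKernel {γ κ θ C₅ : ℝ} (hκ : 0 < κ) (h18 : KernelStepRate F ℰ ρ bV γ κ θ C₅) (hθ0 : 0 ≤ θ) (hθ1 : θ < 1)
    (hdec : KernelDecay F ℰ ρ bV (Window γ) 0 1 κ) {h : ℕ → ℝ} (hh : SeqBox γ h) :
    betaInf (betaMerged F ℰ ρ bV) h = secondMoment (fun μ ν z => betaInf (fun k v => kernelA F ℰ ρ bV (extd v) k μ ν z) h) 0 1 :=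
  (tendsto_betaMerged_revHist_secondMoment_stationaryKernel F ℰ ρ bV hκ h18 hθ0 hθ1 hdec hh).limUnder_eq

/-- Hence the merged β along a reversed history converges to P1's `betaInf (betaMerged F ℰ ρ bV) h` — the conclusion of P1's `tendsto_betaInf`, here WITHOUT the β-level `ScaleShiftRate`.
[cite: Balaban1987RG1, (1.22) p.264 and p.255 (motivation)] -/
theorem tendsto_betaMerged_revHist_betaInf {γ κ θ C₅ : ℝ} (hκ : 0 < κ) (h18 : KernelStepRate F ℰ ρ bV γ κ θ C₅) (hθ0 : 0 ≤ θ) (hθ1 : θ < 1)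
    (hdec : KernelDecay F ℰ ρ bV (Window γ) 0 1 κ) {h : ℕ → ℝ} (hh : SeqBox γ h) :
    Tendsto (fun k : ℕ => betaMerged F ℰ ρ bV k (revHist h k)) atTop (𝓝 (betaInf (betaMerged F ℰ ρ bV) h)) := by
  rw [betaInf_betaMerged_eq_secondMoment_stationaryKernel F ℰ ρ bV hκ h18 hθ0 hθ1 hdec hh]
  exact tendsto_betaMerged_revHist_secondMoment_stationaryKernel F ℰ ρ bV hκ h18 hθ0 hθ1 hdec hh

/-- **β-LEVEL REPRESENTATION**: on the box, `|β_{k+1}(v) − Σ_z Π_∞(padHist p v)(0,1,z) z₀z₁| ≤ (C₅θ^{k+1}∕(1−θ))·betaPrime510 4 1 κ` for any padding value `p ∈ ]0,γ]` — the lattice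
β-function of record IS the (1.22) moment of the stationary kernel of its own (box-continued) history up to the η-tail. [cite: Balaban1987RG1, (1.22) p.264 and (5.10) p.293] -/
theorem abs_betaMerged_sub_secondMoment_stationaryKernel_padHist_le {γ κ θ C₅ p : ℝ} (hκ : 0 < κ) (h18 : KernelStepRate F ℰ ρ bV γ κ θ C₅) (hθ1 : θ < 1)
    (hdec : KernelDecay F ℰ ρ bV (Window γ) 0 1 κ) (hp0 : 0 < p) (hpγ : p ≤ γ) {k : ℕ} {v : Fin (k + 1) → ℝ} (hv : v ∈ Box γ k) :
    |betaMerged F ℰ ρ bV k v - secondMoment (fun μ ν z => betaInf (fun k v => kernelA F ℰ ρ bV (extd v) k μ ν z) (padHist p v)) 0 1| ≤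
      C₅ * θ ^ (k + 1) / (1 - θ) * betaPrime510 4 1 κ := by
  have e := abs_betaMerged_revHist_sub_secondMoment_stationaryKernel_le F ℰ ρ bV hκ h18 hθ1 hdec (padHist_seqBox hp0 hpγ hv) k
  rwa [revHist_padHist] at e

end YMDAG.N18.StationaryKernelOfKernelLetters

end
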